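import Summits.ValiantsHypothesis.ValiantsHypothesis.Theorems.LacunarySymmetroidMatrixDescartesCensusTropicalKLawSlopes

/-!
# Route «KPlusLogSqLaw», crux `TropicalB` (stmt-ValiantsHypothesis-19771) — the PARABOLA CRITERION for dominant chains
# (a closed-form sufficient condition for lower-bound designs)

HONEST FRAMING.  Helper file (seat val-sym-trop-p4 (g2), cell `pub-symmetroid`, 2026-08-26) for the registered stubs of crux `TropicalB`
and for the cell's design seats (D2): a CONSTRUCTIVE tool, valid at every format; it proves no bound on the census and nothing on
`TropicalB` in its window, `WeakLifting`, `MatrixDescartes` (stmt-ValiantsHypothesis-18050) or VP ≠ VNP.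

A dominance design lives in the plane `(slope, value)`: the Leibniz term `q = (σ, λ)` is the point `(x_q, y_q)` with
`x_q = slope d q = ∑_i d(λ_i)` and `y_q = −∑_i v(σ_i, i, λ_i)`, and `tropWeight d v θ q = θ·x_q + y_q`; the dominant terms along
increasing integer slopes `θ` are the vertices of the upper convex hull of these points that carry a unique term.  Lower-bound designs
are usually certified by an LP (uniqueness of the optimum at sample slopes).  This file gives a closed form that needs no LP:

* `isDominant_of_parabola` — if the intended chain terms `p₀, …, p_n` have strictly increasing integer slopes `x₀ < ⋯ < x_n` with gaps
  `≤ G`, lie ON a parabola (`∑ v = x_k² + c`), and every OTHER present term lies at depth `≥ D` below it (`∑ v ≥ x² + c + D`) with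
  `(G − 1)² < 4D` and `D > 0`, then at the explicit integer slopes `θ₀ = 2x₀ − 1`, `θ_k = x_{k−1} + x_k + 1` (strictly increasing) every
  `p_k` is the UNIQUE optimum (`IsDominant`).  (Points on a strictly concave curve are in convex position; a point at depth `D` below the
  curve is below every chord of horizontal extent `< 2√D`.)
* `tropRootLawAt_false_of_parabola` — hence such a chain with alternating signs refutes `TropRootLawAt m K B` for every `B < n`.
[folklore] patchworking along a parabola (Viro / Itenberg–Roy style height functions); elementary.
-/

set_option linter.dupNamespace false
set_option autoImplicit false

namespace Summit.ValiantsHypothesis.ValiantsHypothesis.Theorems.KPlusLogSqLaw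

open Summit.ValiantsHypothesis.ValiantsHypothesis.Theorems.MatrixDescartes.Negative
open Summit.ValiantsHypothesis.ValiantsHypothesis.Theorems.LacunarySymmetroidMatrixDescartes
open Summit.ValiantsHypothesis.ValiantsHypothesis.Theorems.LacunarySymmetroidMatrixDescartes.TropicalCensus
open Finset

/-- the tropical weight in `(slope, value)` coordinates: `tropWeight d v θ q = θ · slope d q − ∑_i v(σ_i, i, λ_i)`. -/
theorem tropWeight_eq_slope {m K : ℕ} (d : Fin K → ℕ) (v : Fin m → Fin m → Fin K → ℤ) (θ : ℤ)
    (q : Equiv.Perm (Fin m) × (Fin m → Fin K)) :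
    tropWeight d v θ q = θ * TropicalCensus.slope d q - ∑ i, v (q.1 i) i (q.2 i) := by
  unfold tropWeight TropicalCensus.slope; rfl

/-- the quarter-square bound: `a·b ≤ ((a+b)/2)²`, in the integer form `4ab ≤ (a+b)²`. [folklore] -/
theorem four_mul_mul_le_sq_add (a b : ℤ) : 4 * (a * b) ≤ (a + b) ^ 2 := by
  nlinarith [sq_nonneg (a - b)]

/-- **Parabola criterion.**  Chain terms on a parabola in the `(slope, value)` plane, every other present term at depth `≥ D` below
it, slope gaps `≤ G` with `(G−1)² < 4D`: then the chain is dominant at the explicit strictly increasing integer slopes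
`θ₀ = 2x₀ − 1`, `θ_k = x_{k−1} + x_k + 1`. [folklore] -/
theorem isDominant_of_parabola {m K n : ℕ} (d : Fin K → ℕ) (v ε : Fin m → Fin m → Fin K → ℤ)
    (p : Fin (n + 1) → Equiv.Perm (Fin m) × (Fin m → Fin K)) (x : Fin (n + 1) → ℤ) (c D G : ℤ)
    (hx : ∀ k, TropicalCensus.slope d (p k) = x k) (hmono : StrictMono x)
    (hgap : ∀ k : Fin n, x k.succ ≤ x k.castSucc + G)
    (hpres : ∀ k, termSign ε (p k) ≠ 0)
    (hon : ∀ k, ∑ i, v ((p k).1 i) i ((p k).2 i) = x k ^ 2 + c)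
    (hoff : ∀ q, termSign ε q ≠ 0 → (∀ k, q ≠ p k) → TropicalCensus.slope d q ^ 2 + c + D ≤ ∑ i, v (q.1 i) i (q.2 i))
    (hD : 0 < D) (hGD : (G - 1) ^ 2 < 4 * D) :
    ∃ θ : Fin (n + 1) → ℤ, StrictMono θ ∧ ∀ k, IsDominant d v ε (θ k) (p k) := by
  -- ℕ-indexed copy of `x` and the explicit slopes
  let X : ℕ → ℤ := fun i => if h : i < n + 1 then x ⟨i, h⟩ else 0
  have hX : ∀ k : Fin (n + 1), X k = x k := by
    intro k; simp only [X, dif_pos k.isLt]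
  have hXmono : ∀ i j : ℕ, i < j → j < n + 1 → X i < X j := by
    intro i j hij hj
    have hi : i < n + 1 := hij.trans hj
    simp only [X, dif_pos hi, dif_pos hj]
    exact hmono (show (⟨i, hi⟩ : Fin (n + 1)) < ⟨j, hj⟩ from hij)
  have hXgap : ∀ i : ℕ, i + 1 < n + 1 → X (i + 1) ≤ X i + G := by
    intro i hi
    have hi' : i < n := by omega
    have h := hgap ⟨i, hi'⟩
    have e1 : X (i + 1) = x (⟨i, hi'⟩ : Fin n).succ := by
      simp only [X, dif_pos hi]; rfl
    have e2 : X i = x (⟨i, hi'⟩ : Fin n).castSucc := by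
      simp only [X, dif_pos (show i < n + 1 by omega)]; rfl
    rw [e1, e2]; exact h
  let θ : Fin (n + 1) → ℤ := fun k => if (k : ℕ) = 0 then 2 * X 0 - 1 else X (k - 1) + X k + 1
  refine ⟨θ, ?_, fun k => ⟨hpres k, fun q hq hqs => ?_⟩⟩
  · -- strict monotonicity of θ
    rw [Fin.strictMono_iff_lt_succ]
    intro k
    have hk1 : (k : ℕ) + 1 < n + 1 := by have := k.isLt; omega
    have e2 : θ k.succ = X k + X ((k : ℕ) + 1) + 1 := by
      simp only [θ, Fin.val_succ, Nat.add_sub_cancel]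
      rw [if_neg (by omega)]
    have e1 : θ k.castSucc = if (k : ℕ) = 0 then 2 * X 0 - 1 else X ((k : ℕ) - 1) + X k + 1 := by
      simp only [θ, Fin.val_castSucc]
    rw [e1, e2]
    by_cases hk0 : (k : ℕ) = 0
    · rw [if_pos hk0, hk0]
      have := hXmono 0 1 (by omega) (by omega)
      linarith
    · rw [if_neg hk0]
      have h1 := hXmono ((k : ℕ) - 1) ((k : ℕ) + 1) (by omega) hk1
      linarith
  · -- dominance of `p k` at `θ k`
    rw [tropWeight_eq_slope, tropWeight_eq_slope, hx k, hon k]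
    have hkX := hX k
    -- the competitor is either another chain term or an off-chain term
    by_cases hch : ∃ j, q = p j
    · obtain ⟨j, rfl⟩ := hch
      have hjk : j ≠ k := fun h => hq (by rw [h])
      rw [hx j, hon j]
      -- sign analysis of `(x k − x j)(θ − x k − x j) > 0`
      have key : 0 < (x k - x j) * (θ k - x k - x j) := by
        rcases lt_or_gt_of_ne hjk with hlt | hgt
        · -- j < k: then k ≠ 0, θ = X(k-1) + X k + 1 and x j ≤ X (k-1)
          have hk0 : (k : ℕ) ≠ 0 := by intro h; exact absurd hlt (by rw [Fin.lt_def, h]; omega)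
          have hθ : θ k = X ((k : ℕ) - 1) + X k + 1 := by simp only [θ, if_neg hk0]
          have hxj : x j ≤ X ((k : ℕ) - 1) := by
            rcases Nat.lt_or_ge (j : ℕ) ((k : ℕ) - 1) with h | h
            · have := hXmono j ((k : ℕ) - 1) h (by have := k.isLt; omega)
              rw [hX j] at this; exact this.le
            · have hj : (j : ℕ) = (k : ℕ) - 1 := by rw [Fin.lt_def] at hlt; omega
              have : X j = X ((k : ℕ) - 1) := by rw [hj]
              rw [← hX j, this]
          have hxjk : x j < x k := hmono hlt
          rw [hθ, hkX]
          exact mul_pos (by linarith) (by linarith)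
        · -- j > k
          have hxkj : x k < x j := hmono hgt
          by_cases hk0 : (k : ℕ) = 0
          · have hθ : θ k = 2 * X 0 - 1 := by simp only [θ, if_pos hk0]
            have hX0 : X 0 = x k := by rw [← hX k, hk0]
            rw [hθ, hX0]
            exact mul_pos_of_neg_of_neg (by linarith) (by linarith)
          · have hθ : θ k = X ((k : ℕ) - 1) + X k + 1 := by simp only [θ, if_neg hk0]
            have h1 : X ((k : ℕ) - 1) < x k := by
              rw [← hX k]; exact hXmono _ _ (by omega) k.isLt
            rw [hθ, hkX]
            exact mul_pos_of_neg_of_neg (by linarith) (by linarith)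
      nlinarith [key]
    · -- off-chain competitor: depth ≥ D below the parabola
      push Not at hch
      have hdeep := hoff q hqs hch
      set s := TropicalCensus.slope d q with hs
      -- it suffices that `(s − x k)(θ − s − x k) < D`
      suffices key : (s - x k) * (θ k - s - x k) < D by nlinarith [key]
      by_cases hk0 : (k : ℕ) = 0
      · have hθ : θ k = 2 * X 0 - 1 := by simp only [θ, if_pos hk0]
        have hX0 : X 0 = x k := by rw [← hX k, hk0]
        rw [hθ, hX0]
        -- `(s − x)(x − 1 − s) = −t(t+1) ≤ 0 < D` with `t = s − x`
        have : 0 ≤ (s - x k) * (s - x k + 1) := by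
          rcases le_or_gt 0 (s - x k) with h | h
          · exact mul_nonneg h (by linarith)
          · nlinarith [mul_nonneg (neg_nonneg.mpr h.le) (show 0 ≤ -(s - x k + 1) by linarith)]
        nlinarith
      · have hθ : θ k = X ((k : ℕ) - 1) + X k + 1 := by simp only [θ, if_neg hk0]
        rw [hθ, hkX]
        set a := x k - s with ha
        set b := s - X ((k : ℕ) - 1) - 1 with hb
        have hab : a + b ≤ G - 1 := by
          have hg := hXgap ((k : ℕ) - 1) (by have := k.isLt; omega)
          have e : (k : ℕ) - 1 + 1 = k := by omega
          rw [e, hkX] at hg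
          rw [ha, hb]; linarith
        have hprod : (s - x k) * (X ((k : ℕ) - 1) + x k + 1 - s - x k) = a * b := by rw [ha, hb]; ring
        rw [hprod]
        rcases le_or_gt a 0 with ha0 | ha0
        · -- `s ≥ x k`: then `b ≥ 0` (as `X (k−1) < x k`), so `a b ≤ 0 < D`
          have h1 : X ((k : ℕ) - 1) < x k := by rw [← hX k]; exact hXmono _ _ (by omega) k.isLt
          have hb0 : 0 ≤ b := by rw [hb]; rw [ha] at ha0; linarith
          nlinarith [mul_nonneg (neg_nonneg.mpr ha0) hb0]
        · rcases le_or_gt b 0 with hb0 | hb0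
          · nlinarith [mul_nonneg ha0.le (neg_nonneg.mpr hb0)]
          · -- both positive: `4ab ≤ (a+b)² ≤ (G−1)² < 4D`
            have h4 := four_mul_mul_le_sq_add a b
            have hsq : (a + b) ^ 2 ≤ (G - 1) ^ 2 := by
              have h0 : 0 ≤ a + b := by linarith
              nlinarith
            nlinarith

/-- **A parabola chain with alternating signs refutes the row.**  Under the hypotheses of `isDominant_of_parabola` plus sign alternation
and `|ε| ≤ 1`, `TropRootLawAt m K B` fails for every `B < n`. -/
theorem tropRootLawAt_false_of_parabola {m K n : ℕ} (d : Fin K → ℕ) (v ε : Fin m → Fin m → Fin K → ℤ)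
    (p : Fin (n + 1) → Equiv.Perm (Fin m) × (Fin m → Fin K)) (x : Fin (n + 1) → ℤ) (c D G : ℤ)
    (hε : ∀ i j l, (ε i j l).natAbs ≤ 1)
    (hx : ∀ k, TropicalCensus.slope d (p k) = x k) (hmono : StrictMono x)
    (hgap : ∀ k : Fin n, x k.succ ≤ x k.castSucc + G)
    (hpres : ∀ k, termSign ε (p k) ≠ 0)
    (hon : ∀ k, ∑ i, v ((p k).1 i) i ((p k).2 i) = x k ^ 2 + c)
    (hoff : ∀ q, termSign ε q ≠ 0 → (∀ k, q ≠ p k) → TropicalCensus.slope d q ^ 2 + c + D ≤ ∑ i, v (q.1 i) i (q.2 i))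
    (hD : 0 < D) (hGD : (G - 1) ^ 2 < 4 * D)
    (halt : ∀ k : Fin n, termSign ε (p k.castSucc) * termSign ε (p k.succ) < 0)
    {B : ℕ} (hB : B < n) : ¬ TropRootLawAt m K B := by
  obtain ⟨θ, hθ, hdom⟩ := isDominant_of_parabola d v ε p x c D G hx hmono hgap hpres hon hoff hD hGD
  intro h
  have := h d v ε n θ p hε hθ hdom halt
  omega

end Summit.ValiantsHypothesis.ValiantsHypothesis.Theorems.KPlusLogSqLaw
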